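import Literature.AnabelianGeometry.EtaleTheta.Discharge.Sec3Cor38WeakPiNatInstance
import Literature.AnabelianGeometry.EtaleTheta.Discharge.Sec3Cor38iiiWeakPiNatInstanceR
import Literature.AnabelianGeometry.EtaleTheta.Discharge.Sec3Prop34CnstOfRlfRWeak
import Literature.AnabelianGeometry.EtaleTheta.Discharge.Sec3FLambdaInvOfRlfWeak
import HarnessLib

/-!
# [EtTh] Corollary 3.8 (i) and (ii) AS TYPED, monoid type `Λ = ℝ`, hold OUTRIGHT at the weak `ℝ`-realified tempered
# Frobenioid with INFINITELY many special-fibre components — and Cor. 3.8 (i) ∧ (ii) ∧ (iii) with no binder there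

S. Mochizuki, *The étale theta function and its Frobenioid-theoretic manifestations*, Publ. RIMS **45** (2009),
Cor. 3.8 (i)–(iii), statement PDF p. 80, proof pp. 81–82 [cite: MochizukiEtTh2009, Cor 3.8 p.80]; Def. 3.3 (iii)
p. 73, Rmk. 3.3.1 p. 73, Prop. 3.4 (ii) p. 74, Def. 3.6 (i)/(ii) pp. 76–77 ("`Λ ∈ {ℤ, ℚ, ℝ}` … `B₀^ℝ := ℝ·Φ₀^birat`,
`F₀^ℝ := ℝ·Φ₀^cnst`"), Rmk. 3.6.3 p. 79; S. Mochizuki, *The geometry of Frobenioids I* (2008), §0 p. 10, Def. 2.4 (i)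
pp. 47–48 [cite: MochizukiFrdI2008, Def. 2.4(i) p.47].

abc-iut cell, layer L2, cone nodes `EtTh:Cor3.8(i)` / `EtTh:Cor3.8(ii)`, row «COR38-NV@WeakPiNatR», seat abc-iut-L2-d2
(gen 5).  PROOF-ONLY (0 definitions) — the monoid-type-`ℝ` companion of this seat's
`Discharge/Sec3Cor38WeakPiNatInstance.lean` (p445706: the same at `Λ = ℤ`) and of `Discharge/Sec3Cor38iiiWeakPiNatInstanceR.lean`
(p443651: Cor. 3.8 (iii) at the `ℝ`-witness).

THE WITNESS.  `C := WeakPiNat.genuineTemperedFrobenioidR R S` (`TemperedFrobenioidGenuineWeakPiNatR.lean`, p443334): the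
Def. 3.6 (ii) tempered Frobenioid of monoid type `ℝ` over abc-iut-L6-t12's weak constructed data
`RealifiedDivisorMonoids.ofRlfRWeak WeakPiNat.divisorMonoids _` (`B₀^ℝ = ℝ·Φ₀^birat`, `F₀^ℝ = B₀^ℝ ∩ ℝ·Φ₀^cnst`) at the
Def. 3.3 (iii) datum `Φ₀ := ∏_ℕ ℤ_{≥0}` (infinitely many special-fibre components, F-L2d2-1), `B₀ = F₀ := ϖ^ℤ`,
`div₀(ϖ) := d = (1, 1, …)`, `Φ := im(Φ₀^pf → Φ₀^rlf)`, genuine vocabularies `treeMonoidVocabWeak` / `treeCatVocab`.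

THE CLOSERS at monoid type `ℝ` are the `Λ`-GENERIC weak node closers — abc-iut-w6-d039's
`Cor38Hyp.cor38_i_weak_of_coord` (p439433) and abc-iut-L1-t12's `Cor38Hyp.cor38_ii_weak_of_coord` (p441772) — with the
print-level input list, per side: `hF` ([FrdI] Thm. 5.2 (ii)) · `hP34Λ` (Prop. 3.4 (ii) at monoid type `Λ`) · `hNZ`
(Def. 3.6 (ii)(b), bracketed sentence) · `hQ` (Rmk. 3.3.1 / [FrdI] Def. 2.4 (i)(b): `ℚ`-monoprime localized perfections)
· [`hFinv` (`F₀^Λ` inverse-closed) — (ii) only].  THIS FILE checks every one of them at the `ℝ`-witness: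

* §1 `biratGp_le_cnstGp` (all functions are constant: `Φ₀^birat = Φ₀^cnst`), hence **`effRealSpan_weak`** — the `Λ = ℝ`
  effective-locus clause `hE` of Prop. 3.4 (ii) (census A2, GAP G-w5d130-1) HOLDS at the datum — and
  **`prop34Cnst_realifiedR : realifiedR.Prop34Cnst (𝟭 _)`** (abc-iut-L6-t12's `Prop34Cnst.ofRlfRWeak_of_eff` with this seat's
  `prop34Cnst₀_divisorMonoids`); `ratSupport_genuineTemperedFrobenioidR` (hsat), **`hQ_genuineTemperedFrobenioidR`**
  (abc-iut-L6-t12's `isQMonoprime_pfAt_divisorMonoid_of_ratSupport_weak`, (hZQ) = p445706's `isZQMonoprime_primes_Φ₀`),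
  `exists_cnstFn_effective_genuineTemperedFrobenioidR` (`hNZ`, abc-iut-L6-t12's `…_ofRlfRWeak_of_prop34Const`), `hFinv` :=
  abc-iut-L6-t12's UNCONDITIONAL `ofRlfRWeak_hFinv'`, `remark363_genuineTemperedFrobenioidR` (its unconditional
  `remark363_ofRlfRWeak`), **`bsFldPreStepLimitCriterion_genuineTemperedFrobenioidR`** (row C38-L05 at the `ℝ`-witness,
  abc-iut-w4-d084's `bsFldPreStepLimitCriterion_of_coordWeak`);
* §2 **`cor38_i_genuineTemperedFrobenioidR (h) : Cor38_i IsFrobeniusSlim h`**, `preservesBaseFieldTheoretic_…R`;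
* §3 **`cor38_ii_genuineTemperedFrobenioidR (h) : Cor38_ii (Def. 4.5 (iv)) h`**, `cor38_ii_conclusion_…R`;
* §4 **`cor38_genuineTemperedFrobenioidR (h) : Cor38_i … h ∧ Cor38_ii … h ∧ Cor38_iii h`**, its conclusion form, and
  `exists_…` with this seat's inhabitant `nonempty_cor38HypR` — [EtTh] Cor. 3.8 (i), (ii), (iii) AS TYPED fire
  SIMULTANEOUSLY with NO binder at BOTH monoid types `ℤ` (p445706) and `ℝ` (here) over weak data with infinitely many
  special-fibre components.

HONEST LABEL: a consistency / instantiation certificate at DEGENERATE geometry (one object, no cusps, constant functions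
only) over GENUINE vocabularies — NOT the realified tempered Frobenioid of a curve; refereed pre-IUT material; nothing
here bears on [IUTchIII] Cor. 3.12; no side taken; typed ≠ proved.
-/

noncomputable section

namespace Literature.AnabelianGeometry.EtaleTheta

open CategoryTheory Opposite Function Literature.AlgebraicGeometry.Frobenioids

namespace WeakPiNat

/-! ## §1 The print-level input clauses at the `ℝ`-witness -/

/-- **`Φ₀^birat ⊆ Φ₀^cnst` for the datum** (all log-meromorphic functions are constant: `F₀ = B₀ = ϖ^ℤ`), at the level of
the generated subfunctors of groups. [cite: MochizukiEtTh2009, Def 3.3 p.73] -/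
theorem biratGp_le_cnstGp (X : Discrete PUnit.{1}) :
    WeakPiNat.divisorMonoids.biratGp.carrier X ≤ WeakPiNat.divisorMonoids.cnstGp.carrier X :=
  Subgroup.closure_mono (by
    rintro _ ⟨b, rfl⟩
    exact ⟨b, Submonoid.mem_top _, rfl⟩)

/-- **The `Λ = ℝ` effective-locus clause `hE` of [EtTh] Prop. 3.4 (ii) HOLDS for the datum** (census A2, GAP G-w5d130-1:
"an element of `ℝ·Φ₀^birat(Y)` with effective image lies in `ℝ·Φ₀^cnst(Y)`", for THE weak realification data) — here
even without the effectivity premise, since `ℝ·Φ₀^birat = ℝ·Φ₀^cnst` (spans are monotone, abc-iut-L6-t12's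
`realSpan_mono`). [cite: MochizukiEtTh2009, Prop 3.4 (ii) p.74] -/
theorem effRealSpan_weak (Y : Discrete PUnit.{1})
    (b : Algebra.GrothendieckGroup
      ((RealifiedDivisorMonoids.realDataWeak WeakPiNat.divisorMonoids isPerfFactorialCof_Φ₀).rlf.obj (op Y)))
    (x : (isPerfFactorialCof_Φ₀ (op Y)).weak.Rlf)
    (hb : b ∈ ((RealifiedDivisorMonoids.realDataWeak WeakPiNat.divisorMonoids isPerfFactorialCof_Φ₀).realSpan
      WeakPiNat.divisorMonoids.biratGp).carrier Y)
    (_hbx : b = Algebra.GrothendieckGroup.of x) :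
    b ∈ ((RealifiedDivisorMonoids.realDataWeak WeakPiNat.divisorMonoids isPerfFactorialCof_Φ₀).realSpan
      WeakPiNat.divisorMonoids.cnstGp).carrier Y :=
  RealificationDataLemmas.realSpan_mono _ Y (biratGp_le_cnstGp Y) hb

/-- **abc-iut-L2-t3's Prop. 3.4 (ii)-relative-to-`D^cnst` structure `Prop34Cnst` HOLDS for the weak `ℝ`-realified data
`WeakPiNat.realifiedR = ofRlfRWeak divisorMonoids _`** (`cnst := 𝟭`): abc-iut-L6-t12's assembly `Prop34Cnst.ofRlfRWeak_of_eff`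
from this seat's `prop34Cnst₀_divisorMonoids` (p445706) and `hE ✓`. [cite: MochizukiEtTh2009, Prop 3.4 (ii) p.74] -/
theorem prop34Cnst_realifiedR : WeakPiNat.realifiedR.Prop34Cnst (𝟭 (Discrete PUnit.{1})) :=
  RealifiedDivisorMonoids.Prop34Cnst.ofRlfRWeak_of_eff prop34Cnst₀_divisorMonoids
    fun Y b x hb hbx => effRealSpan_weak Y b x hb hbx

variable (R S : ((Discrete PUnit.{1})ᵒᵖ ⥤ CommMonCat.{0}) → Prop)

/-- **(hsat) at the `ℝ`-witness**: every `x ∈ Φ(W) = im(Φ₀^pf → Φ₀^rlf)` has a power in the image of `Φ₀(Y_W) → Φ₀^ℝ(Y_W)`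
(the map `Φ₀ → Φ₀^ℝ` of `ofRlfRWeak` is that of `ofRlfZWeak`). [cite: MochizukiEtTh2009, Def 3.6 p.76] -/
theorem ratSupport_genuineTemperedFrobenioidR (W : Discrete PUnit.{1}) :
    ∀ x ∈ (WeakPiNat.genuineTemperedFrobenioidR R S).Φ.carrier (op W),
      ∃ (N : ℕ+) (d : WeakPiNat.realifiedR.Φ₀.obj ((WeakPiNat.genuineTemperedFrobenioidR R S).baseOp (op W))),
        x ^ (N : ℕ) = WeakPiNat.realifiedR.toR ((WeakPiNat.genuineTemperedFrobenioidR R S).baseOp (op W)) d := by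
  rintro x ⟨a, rfl⟩
  obtain ⟨⟨c, n⟩, rfl⟩ := Perfection.mk_surjective a
  refine ⟨n, c, ?_⟩
  change (isPerfFactorialCof_Φ₀ _).weak.toRealification (Perfection.mk c n) ^ (n : ℕ) =
    (isPerfFactorialCof_Φ₀ _).weak.toRealification (Perfection.of _ c)
  rw [← map_pow, Perfection.mk_pow_self]

/-- **`hQ` OUTRIGHT at the `ℝ`-witness**: every localized perfection `Φ(W)^pf_𝔮` is `ℚ`-monoprime (abc-iut-L6-t12's
`isQMonoprime_pfAt_divisorMonoid_of_ratSupport_weak`, (hZQ) := p445706's `isZQMonoprime_primes_Φ₀`, (hsat) above).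
[cite: MochizukiEtTh2009, Def 3.6 p.77] -/
theorem hQ_genuineTemperedFrobenioidR (W : Discrete PUnit.{1})
    (𝔮 : Primes (Perfection ((WeakPiNat.genuineTemperedFrobenioidR R S).divisorMonoid.obj (op W)))) :
    IsQMonoprime (PfAt ((WeakPiNat.genuineTemperedFrobenioidR R S).divisorMonoid.obj (op W)) 𝔮) :=
  TemperedFrobenioid.isQMonoprime_pfAt_divisorMonoid_of_ratSupport_weak W (fun 𝔭 => isZQMonoprime_primes_Φ₀ _ 𝔭)
    (ratSupport_genuineTemperedFrobenioidR R S W) 𝔮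

/-- **`hNZ` — Def. 3.6 (ii)(b), bracketed sentence — OUTRIGHT at the `ℝ`-witness** (abc-iut-L6-t12's
`exists_cnstFn_effective_ofRlfRWeak_of_prop34Const` with this seat's `prop34Const_divisorMonoids`).
[cite: MochizukiEtTh2009, Def 3.6 p.77] -/
theorem exists_cnstFn_effective_genuineTemperedFrobenioidR (A : (Discrete PUnit.{1})ᵒᵖ) :
    ∃ u : (WeakPiNat.realifiedR.BΛ.obj ((WeakPiNat.genuineTemperedFrobenioidR R S).baseOp A) : Type) ×
        Algebra.GrothendieckGroup ((WeakPiNat.genuineTemperedFrobenioidR R S).Φ.carrier A),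
      u ∈ (WeakPiNat.genuineTemperedFrobenioidR R S).cnstFn A ∧
        ∃ Z : (WeakPiNat.genuineTemperedFrobenioidR R S).Φ.carrier A, Z ≠ 1 ∧ u.2 = Algebra.GrothendieckGroup.of Z :=
  (WeakPiNat.genuineTemperedFrobenioidR R S).exists_cnstFn_effective_ofRlfRWeak_of_prop34Const
    prop34Const_divisorMonoids A

/-- **[EtTh] Rmk. 3.6.3 at the `ℝ`-witness** — abc-iut-L6-t12's UNCONDITIONAL `remark363_ofRlfRWeak`.
[cite: MochizukiEtTh2009, Rmk 3.6.3 p.79] -/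
theorem remark363_genuineTemperedFrobenioidR : (WeakPiNat.genuineTemperedFrobenioidR R S).Remark363 :=
  (WeakPiNat.genuineTemperedFrobenioidR R S).remark363_ofRlfRWeak

/-- **Row C38-L05 (the base-field-theoretic pre-step criterion at THE perfection) OUTRIGHT at the `ℝ`-witness**, for
the perfection attached to this seat's Frobenioid certificate `isFrobenioid_genuineTemperedFrobenioidR` — abc-iut-w4-d084's
`bsFldPreStepLimitCriterion_of_coordWeak` with `hP34Λ ✓` (`prop34Cnst_realifiedR`), `hNZ ✓`, `hQ ✓`.
[cite: MochizukiEtTh2009, Cor 3.8 p.81] -/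
theorem bsFldPreStepLimitCriterion_genuineTemperedFrobenioidR :
    (WeakPiNat.genuineTemperedFrobenioidR R S).BsFldPreStepLimitCriterion
      (PreFrobenioidData.perfection (isFrobenioid_genuineTemperedFrobenioidR R S)) :=
  (WeakPiNat.genuineTemperedFrobenioidR R S).bsFldPreStepLimitCriterion_of_coordWeak
    (isFrobenioid_genuineTemperedFrobenioidR R S) prop34Cnst_realifiedR.mem_FΛ_of_divΛ_eq_of
    (exists_cnstFn_effective_genuineTemperedFrobenioidR R S) (hQ_genuineTemperedFrobenioidR R S)

/-! ## §2 [EtTh] Cor. 3.8 (i) AS TYPED at monoid type `ℝ`, and its conclusion -/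

variable (R' S' : ((Discrete PUnit.{1})ᵒᵖ ⥤ CommMonCat.{0}) → Prop)

/-- **[EtTh] Cor. 3.8 (i) AS TYPED (vocabulary parameter := `IsFrobeniusSlim`) holds with NO hypothesis for EVERY Cor. 3.8
datum `h` between two weak `ℝ`-witnesses at `Φ₀ = ∏_ℕ ℤ_{≥0}`** — abc-iut-w6-d039's `Λ`-generic node closer
`Cor38Hyp.cor38_i_weak_of_coord` with `hF`, `hP34Λ`, `hNZ`, `hQ` per side CHECKED at the `ℝ`-witness.
[cite: MochizukiEtTh2009, Cor 3.8 p.80] -/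
theorem cor38_i_genuineTemperedFrobenioidR
    (h : Cor38Hyp (WeakPiNat.genuineTemperedFrobenioidR R S) (WeakPiNat.genuineTemperedFrobenioidR R' S')) :
    Literature.AnabelianGeometry.EtaleTheta.Cor38_i
      (fun E _ => Literature.AlgebraicGeometry.Frobenioids.IsFrobeniusSlim E) h :=
  h.cor38_i_weak_of_coord (isFrobenioid_genuineTemperedFrobenioidR R S) (isFrobenioid_genuineTemperedFrobenioidR R' S')
    prop34Cnst_realifiedR.mem_FΛ_of_divΛ_eq_of (exists_cnstFn_effective_genuineTemperedFrobenioidR R S)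
    (hQ_genuineTemperedFrobenioidR R S) prop34Cnst_realifiedR.mem_FΛ_of_divΛ_eq_of
    (exists_cnstFn_effective_genuineTemperedFrobenioidR R' S') (hQ_genuineTemperedFrobenioidR R' S')

/-- **The CONCLUSION of [EtTh] Cor. 3.8 (i) at the `ℝ`-witness, for every `h`**: the one-object base is slim (abc-iut-L1's
`isSlim_discretePUnit`), hence Frobenius-slim. [cite: MochizukiEtTh2009, Cor 3.8 p.80] -/
theorem preservesBaseFieldTheoretic_genuineTemperedFrobenioidR
    (h : Cor38Hyp (WeakPiNat.genuineTemperedFrobenioidR R S) (WeakPiNat.genuineTemperedFrobenioidR R' S')) :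
    Literature.AnabelianGeometry.EtaleTheta.PreservesBaseFieldTheoretic h :=
  cor38_i_genuineTemperedFrobenioidR R S R' S' h isSlim_discretePUnit.isFrobeniusSlim
    isSlim_discretePUnit.isFrobeniusSlim

/-! ## §3 [EtTh] Cor. 3.8 (ii) AS TYPED at monoid type `ℝ`, and its conclusion -/

/-- **[EtTh] Cor. 3.8 (ii) AS TYPED (vocabulary parameter := [FrdI] Def. 4.5 (iv) "Div-slim") holds with NO hypothesis for
EVERY Cor. 3.8 datum `h` between two weak `ℝ`-witnesses at `Φ₀ = ∏_ℕ ℤ_{≥0}`** — abc-iut-L1-t12's `Λ`-generic node closer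
`Cor38Hyp.cor38_ii_weak_of_coord` with `hF`, `hP34Λ`, `hNZ`, `hQ`, `hFinv` per side CHECKED (`hFinv` = abc-iut-L6-t12's
unconditional `ofRlfRWeak_hFinv'`: `F₀^ℝ` is a group). [cite: MochizukiEtTh2009, Cor 3.8 p.81] -/
theorem cor38_ii_genuineTemperedFrobenioidR
    (h : Cor38Hyp (WeakPiNat.genuineTemperedFrobenioidR R S) (WeakPiNat.genuineTemperedFrobenioidR R' S')) :
    Literature.AnabelianGeometry.EtaleTheta.Cor38_ii
      (fun E _ Φ => ∀ (A : E) (α : Aut (Over.forget A)),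
        (∀ (B : Over A) (x : Φ.obj (op B.left)),
          Literature.AlgebraicGeometry.Frobenioids.pull Φ (α.hom.app B) x = x) → α = 1) h :=
  h.cor38_ii_weak_of_coord (isFrobenioid_genuineTemperedFrobenioidR R S) (isFrobenioid_genuineTemperedFrobenioidR R' S')
    prop34Cnst_realifiedR.mem_FΛ_of_divΛ_eq_of (exists_cnstFn_effective_genuineTemperedFrobenioidR R S)
    (hQ_genuineTemperedFrobenioidR R S)
    (RealifiedDivisorMonoids.ofRlfRWeak_hFinv' WeakPiNat.divisorMonoids isPerfFactorialCof_Φ₀)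
    prop34Cnst_realifiedR.mem_FΛ_of_divΛ_eq_of (exists_cnstFn_effective_genuineTemperedFrobenioidR R' S')
    (hQ_genuineTemperedFrobenioidR R' S')
    (RealifiedDivisorMonoids.ofRlfRWeak_hFinv' WeakPiNat.divisorMonoids isPerfFactorialCof_Φ₀)

/-- **The CONCLUSION of [EtTh] Cor. 3.8 (ii) at the `ℝ`-witness, for every `h`**: `Ψ` preserves the base-field-theoretic
morphisms and induces a compatible equivalence of the base-field-theoretic hulls (the base is Div-slim, abc-iut-w6-d040's
`Toy.isDivSlim45iv_discretePUnit`). [cite: MochizukiEtTh2009, Cor 3.8 p.81] -/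
theorem cor38_ii_conclusion_genuineTemperedFrobenioidR
    (h : Cor38Hyp (WeakPiNat.genuineTemperedFrobenioidR R S) (WeakPiNat.genuineTemperedFrobenioidR R' S')) :
    PreservesBaseFieldTheoretic h ∧
      ∃ Ψbs : (WeakPiNat.genuineTemperedFrobenioidR R S).hullCategory ≌
          (WeakPiNat.genuineTemperedFrobenioidR R' S').hullCategory,
        Nonempty ((WeakPiNat.genuineTemperedFrobenioidR R S).hull ⋙ h.Ψ.functor ≅
          Ψbs.functor ⋙ (WeakPiNat.genuineTemperedFrobenioidR R' S').hull) :=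
  cor38_ii_genuineTemperedFrobenioidR R S R' S' h (Toy.isDivSlim45iv_discretePUnit _)
    (Toy.isDivSlim45iv_discretePUnit _)

/-! ## §4 [EtTh] Cor. 3.8 (i) ∧ (ii) ∧ (iii) simultaneously at monoid type `ℝ`, infinitely many components -/

/-- **[EtTh] Cor. 3.8 (i), (ii) AND (iii) AS TYPED hold SIMULTANEOUSLY, with NO hypothesis beyond `h`, for every Cor. 3.8
datum `h` between two weak `ℝ`-witnesses at `Φ₀ = ∏_ℕ ℤ_{≥0}`** — (iii) = this seat's `cor38_iii_genuineTemperedFrobenioidR`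
(p443651).  With p445706 (`Λ = ℤ`): the cell's weak [EtTh] §3 chain fires in all three parts at BOTH monoid types over
data with infinitely many special-fibre components. [cite: MochizukiEtTh2009, Cor 3.8 p.80] -/
theorem cor38_genuineTemperedFrobenioidR
    (h : Cor38Hyp (WeakPiNat.genuineTemperedFrobenioidR R S) (WeakPiNat.genuineTemperedFrobenioidR R' S')) :
    Literature.AnabelianGeometry.EtaleTheta.Cor38_i
        (fun E _ => Literature.AlgebraicGeometry.Frobenioids.IsFrobeniusSlim E) h ∧
      Literature.AnabelianGeometry.EtaleTheta.Cor38_ii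
        (fun E _ Φ => ∀ (A : E) (α : Aut (Over.forget A)),
          (∀ (B : Over A) (x : Φ.obj (op B.left)),
            Literature.AlgebraicGeometry.Frobenioids.pull Φ (α.hom.app B) x = x) → α = 1) h ∧
      Cor38_iii h :=
  ⟨cor38_i_genuineTemperedFrobenioidR R S R' S' h, cor38_ii_genuineTemperedFrobenioidR R S R' S' h,
    cor38_iii_genuineTemperedFrobenioidR R S R' S' h⟩

/-- **The CONCLUSIONS of [EtTh] Cor. 3.8 (i), (ii), (iii) simultaneously at the `ℝ`-witness, for every `h`.**
[cite: MochizukiEtTh2009, Cor 3.8 p.80] -/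
theorem cor38_conclusion_genuineTemperedFrobenioidR
    (h : Cor38Hyp (WeakPiNat.genuineTemperedFrobenioidR R S) (WeakPiNat.genuineTemperedFrobenioidR R' S')) :
    PreservesBaseFieldTheoretic h ∧
      (∃ Ψbs : (WeakPiNat.genuineTemperedFrobenioidR R S).hullCategory ≌
          (WeakPiNat.genuineTemperedFrobenioidR R' S').hullCategory,
        Nonempty ((WeakPiNat.genuineTemperedFrobenioidR R S).hull ⋙ h.Ψ.functor ≅
          Ψbs.functor ⋙ (WeakPiNat.genuineTemperedFrobenioidR R' S').hull)) ∧
      Cor38_iii h :=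
  ⟨preservesBaseFieldTheoretic_genuineTemperedFrobenioidR R S R' S' h,
    (cor38_ii_conclusion_genuineTemperedFrobenioidR R S R' S' h).2, cor38_iii_genuineTemperedFrobenioidR R S R' S' h⟩

/-- **The typed statements of the nodes `EtTh:Cor3.8(i)`, `(ii)`, `(iii)` have a SIMULTANEOUS unconditional kernel instance
at monoid type `ℝ` and infinitely many special-fibre components** (this seat's inhabitant `nonempty_cor38HypR`, `Ψ := 𝟭`).
[cite: MochizukiEtTh2009, Cor 3.8 p.80] -/
theorem exists_cor38Hyp_cor38_R :
    ∃ h : Cor38Hyp (WeakPiNat.genuineTemperedFrobenioidR R S) (WeakPiNat.genuineTemperedFrobenioidR R S),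
      Literature.AnabelianGeometry.EtaleTheta.Cor38_i
          (fun E _ => Literature.AlgebraicGeometry.Frobenioids.IsFrobeniusSlim E) h ∧
        Literature.AnabelianGeometry.EtaleTheta.Cor38_ii
          (fun E _ Φ => ∀ (A : E) (α : Aut (Over.forget A)),
            (∀ (B : Over A) (x : Φ.obj (op B.left)),
              Literature.AlgebraicGeometry.Frobenioids.pull Φ (α.hom.app B) x = x) → α = 1) h ∧
        Cor38_iii h := by
  obtain ⟨h⟩ := nonempty_cor38HypR R S
  exact ⟨h, cor38_genuineTemperedFrobenioidR R S R S h⟩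

/-- … and so have their conclusions, at monoid type `ℝ`. [cite: MochizukiEtTh2009, Cor 3.8 p.80] -/
theorem exists_cor38Hyp_cor38_conclusion_R :
    ∃ h : Cor38Hyp (WeakPiNat.genuineTemperedFrobenioidR R S) (WeakPiNat.genuineTemperedFrobenioidR R S),
      PreservesBaseFieldTheoretic h ∧
        (∃ Ψbs : (WeakPiNat.genuineTemperedFrobenioidR R S).hullCategory ≌
            (WeakPiNat.genuineTemperedFrobenioidR R S).hullCategory,
          Nonempty ((WeakPiNat.genuineTemperedFrobenioidR R S).hull ⋙ h.Ψ.functor ≅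
            Ψbs.functor ⋙ (WeakPiNat.genuineTemperedFrobenioidR R S).hull)) ∧
        Cor38_iii h := by
  obtain ⟨h⟩ := nonempty_cor38HypR R S
  exact ⟨h, cor38_conclusion_genuineTemperedFrobenioidR R S R S h⟩

end WeakPiNat

end Literature.AnabelianGeometry.EtaleTheta

end
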